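import Literature.GroupTheory.SpecificGroups.AlternatingSixPSL2NineLabelling
import Mathlib.FieldTheory.Finite.GaloisField
import HarnessLib

/-!
# The exceptional isomorphism `A₆ ≅ PSL₂(𝔽₉)`, II: the isomorphism

`AltSixPSL.nonempty_alternatingGroup_mulEquiv_PSL`: for every field `K` with nine elements,
`alternatingGroup (Fin 6) ≃* PSL(2, K)` (`A₁(9) ≅ A₆`, Gorenstein, *Finite Simple Groups*, (2.7)),
completing Wilson's argument (*The Finite Simple Groups*, §3.3.5) begun in
`AlternatingSixPSL2NineLabelling.lean`: by `AltSixPSL.exists_sl_of_mem_alternatingGroup` the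
action of `A₆` on the ten bisections, transported to `ℙ¹(𝔽₉)` along Wilson's labelling `e` (a
bijection: injective between sets of size `10 = 9 + 1`), lands in the image of `PSL₂(𝔽₉)` in
`Perm ℙ¹(𝔽₉)`; `A₆` is simple (Mathlib `alternatingGroup.isSimpleGroup`) and acts non-trivially,
so the action is faithful, and `PSL₂(𝔽₉) →* Perm ℙ¹(𝔽₉)` is injective (Mathlib
`Matrix.ProjectiveSpecialLinearGroup.toPermHom_injective`); this gives a monomorphism
`A₆ →* PSL₂(𝔽₉)` between groups of order `360` (`|SL₂(𝔽₉)| = 720` by enumeration, `±1` central),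
hence an isomorphism — Wilson's closing count. Finally `PSL₂` is transported along a ring
isomorphism `𝔽₃[i] ≃+* K` (Mathlib `FiniteField.ringEquivOfCardEq`).

This file only contains theorems (existence of the isomorphism); the named objects live in part I.

## References

* R. A. Wilson, *The Finite Simple Groups*, GTM 251, Springer 2009, §3.3.5, p. 53. [Wilson2009]
* D. Gorenstein, *Finite Simple Groups*, Plenum 1982, §2.1 (2.7). [Gorenstein1982]
-/

open scoped LinearAlgebra.Projectivization MatrixGroups Pointwise

namespace Literature.GroupTheory.SpecificGroups

namespace AltSixPSL

/-- Wilson's labelling is a bijection `B ≃ ℙ¹(𝔽₉)` (injective, and `|ℙ¹(𝔽₉)| = 9 + 1 = |B|`).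
[cite: Wilson2009, §3.3.5] -/
theorem e_bijective : Function.Bijective e :=
  e_injective.bijective_of_nat_card_le (by
    rw [Projectivization.card_of_finrank_two F9 (Fin 2 → F9) (Module.finrank_fin_fun F9),
      Nat.card_eq_fintype_card, card_F9, Nat.card_eq_fintype_card, card_B])

/-- `(0 1)(2 3)` moves the bisection `(012|345)`: `A₆` acts non-trivially on bisections.
[folklore] -/
theorem swap_mul_swap_smul_ne : (Equiv.swap (0 : Fin 6) 1 * Equiv.swap 2 3) • b₀ ≠ b₀ := by
  decide +kernel

/-- `A₆` acts faithfully on the bisections: `A₆` is simple (Mathlib) and the action is non-trivial.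
[folklore] -/
theorem toPermHom_comp_subtype_injective :
    Function.Injective
      ((MulAction.toPermHom (Equiv.Perm (Fin 6)) B).comp (alternatingGroup (Fin 6)).subtype) := by
  set a := (MulAction.toPermHom (Equiv.Perm (Fin 6)) B).comp (alternatingGroup (Fin 6)).subtype
  haveI : IsSimpleGroup (alternatingGroup (Fin 6)) := alternatingGroup.isSimpleGroup (by simp)
  refine (MonoidHom.ker_eq_bot_iff a).mp
    ((MonoidHom.normal_ker a).eq_bot_or_eq_top.elim id fun h => ?_)
  have hmem : (⟨Equiv.swap 0 1 * Equiv.swap 2 3, Equiv.Perm.mul_mem_alternatingGroup_of_isSwap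
      ⟨0, 1, by decide, rfl⟩ ⟨2, 3, by decide, rfl⟩⟩ : alternatingGroup (Fin 6)) ∈ a.ker :=
    h ▸ Subgroup.mem_top _
  exact absurd (Equiv.congr_fun (MonoidHom.mem_ker.mp hmem) b₀) swap_mul_swap_smul_ne

/-- `|A₆| = 360`. [folklore] -/
theorem natCard_alternatingGroup : Nat.card (alternatingGroup (Fin 6)) = 360 := by
  rw [nat_card_alternatingGroup, Nat.card_eq_fintype_card, Fintype.card_fin]
  decide

/-- `|SL₂(𝔽₉)| = 720` (by enumeration of the `9⁴` matrices). [folklore] -/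
theorem card_SL : Fintype.card SL(2, F9) = 720 := by
  decide +kernel

/-- `-1 ∈ SL₂(𝔽₉)` is a non-trivial central element. [folklore] -/
theorem exists_mem_center_ne_one : ∃ z ∈ Subgroup.center SL(2, F9), z ≠ 1 :=
  ⟨⟨!![-1, 0; 0, -1], by decide +kernel⟩,
    Matrix.SpecialLinearGroup.mem_center_iff.mpr ⟨-1, by simp, by decide +kernel⟩,
    by decide +kernel⟩

/-- `|PSL₂(𝔽₉)| ≤ 360` (`720 = |PSL₂(𝔽₉)| · |Z(SL₂(𝔽₉))|` and `±1 ∈ Z`). [folklore] -/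
theorem natCard_PSL_le : Nat.card PSL(2, F9) ≤ 360 := by
  have h := Subgroup.card_eq_card_quotient_mul_card_subgroup (Subgroup.center SL(2, F9))
  rw [Nat.card_eq_fintype_card, card_SL] at h
  obtain ⟨z, hz, hz1⟩ := exists_mem_center_ne_one
  haveI : Nontrivial (Subgroup.center SL(2, F9)) :=
    ⟨⟨⟨z, hz⟩, 1, fun h' => hz1 (congrArg (·.1) h')⟩⟩
  have h2 : 1 < Nat.card (Subgroup.center SL(2, F9)) := Finite.one_lt_card
  change Nat.card (SL(2, F9) ⧸ Subgroup.center SL(2, F9)) ≤ 360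
  nlinarith

/-- **`A₆ ≃* PSL₂(𝔽₉)`** (Gorenstein (2.7): `A₁(9) ≅ A₆`) for the model `𝔽₉ = 𝔽₃[i]`: the action
of `A₆` on bisections, read in `ℙ¹(𝔽₉)` through Wilson's labelling, is a monomorphism into
`PSL₂(𝔽₉)` between two groups of order `360` (Wilson §3.3.5). [cite: Wilson2009, §3.3.5] -/
theorem nonempty_mulEquiv_F9 : Nonempty (alternatingGroup (Fin 6) ≃* PSL(2, F9)) := by
  let ψ := Projectivization.PSLAction.toPermHom (K := F9) (ι := Fin 2)
  let eqv : B ≃ P := Equiv.ofBijective e e_bijective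
  let ρ : alternatingGroup (Fin 6) →* Equiv.Perm P := eqv.permCongrHom.toMonoidHom.comp
    ((MulAction.toPermHom (Equiv.Perm (Fin 6)) B).comp (alternatingGroup (Fin 6)).subtype)
  have hρ : Function.Injective ρ :=
    eqv.permCongrHom.injective.comp toPermHom_comp_subtype_injective
  have hρψ : ∀ σ, ρ σ ∈ ψ.range := fun σ => by
    obtain ⟨g, hg⟩ := exists_sl_of_mem_alternatingGroup σ.2
    refine ⟨(g : PSL(2, F9)), Equiv.ext fun p => ?_⟩
    obtain ⟨b, rfl⟩ := eqv.surjective p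
    have h1 : ρ σ (eqv b) = e ((σ : Equiv.Perm (Fin 6)) • b) := by
      simp [ρ, eqv]
    rw [h1, hg b]
    rfl
  let Ψ : PSL(2, F9) ≃* ψ.range :=
    MonoidHom.ofInjective Matrix.ProjectiveSpecialLinearGroup.toPermHom_injective
  let θ : alternatingGroup (Fin 6) →* PSL(2, F9) := Ψ.symm.toMonoidHom.comp (ρ.codRestrict _ hρψ)
  have hθ : Function.Injective θ := fun x y h => by
    have h1 : ρ.codRestrict _ hρψ x = ρ.codRestrict _ hρψ y := Ψ.symm.injective h
    exact hρ (congrArg Subtype.val h1)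
  exact ⟨MulEquiv.ofBijective θ
    (hθ.bijective_of_nat_card_le (natCard_alternatingGroup ▸ natCard_PSL_le))⟩

/-! ### Changing the field -/

/-- A group isomorphism maps the centre onto the centre. [folklore] -/
theorem map_center_eq {G H : Type*} [Group G] [Group H] (f : G ≃* H) :
    (Subgroup.center G).map (f : G →* H) = Subgroup.center H := by
  ext h
  simp only [Subgroup.mem_map, Subgroup.mem_center_iff, MonoidHom.coe_coe]
  constructor
  · rintro ⟨g, hg, rfl⟩ h'
    obtain ⟨g', rfl⟩ := f.surjective h'
    rw [← map_mul, ← map_mul, hg]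
  · intro hh
    refine ⟨f.symm h, fun g => f.injective ?_, f.apply_symm_apply h⟩
    rw [map_mul, map_mul, f.apply_symm_apply, hh]

/-- `PSL₂` of isomorphic commutative rings are isomorphic (through
`Matrix.SpecialLinearGroup.map` and `QuotientGroup.congr`). [folklore] -/
theorem nonempty_PSL_mulEquiv_of_ringEquiv {K K' : Type*} [CommRing K] [CommRing K']
    (f : K ≃+* K') : Nonempty (PSL(2, K) ≃* PSL(2, K')) := by
  let F : SL(2, K) ≃* SL(2, K') :=
    { Matrix.SpecialLinearGroup.map (f : K →+* K') with
      invFun := Matrix.SpecialLinearGroup.map (f.symm : K' →+* K)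
      left_inv := fun g => Subtype.ext <| by
        ext i j
        exact f.symm_apply_apply _
      right_inv := fun g => Subtype.ext <| by
        ext i j
        exact f.apply_symm_apply _ }
  exact ⟨QuotientGroup.congr _ _ F (map_center_eq F)⟩

/-- **`A₆ ≅ PSL₂(𝔽₉)`** (`A₁(9) ≅ A₆`, Gorenstein, *Finite Simple Groups*, (2.7)) for every field
with nine elements, by Wilson's proof (§3.3.5): `A₆` acting on the ten bisections of six letters and
`PSL₂(9)` acting on `ℙ¹(𝔽₉)` are identified by an explicit labelling under which even permutations
are projective transformations, and both groups have order `360`. [cite: Wilson2009, §3.3.5] -/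
theorem nonempty_alternatingGroup_mulEquiv_PSL (K : Type*) [Field K] [Finite K]
    (hK : Nat.card K = 9) : Nonempty (alternatingGroup (Fin 6) ≃* PSL(2, K)) := by
  haveI := Fintype.ofFinite K
  have hc : Fintype.card F9 = Fintype.card K := by
    rw [card_F9, ← Nat.card_eq_fintype_card, hK]
  obtain ⟨h₁⟩ := nonempty_mulEquiv_F9
  obtain ⟨h₂⟩ := nonempty_PSL_mulEquiv_of_ringEquiv (FiniteField.ringEquivOfCardEq hc)
  exact ⟨h₁.trans h₂⟩

end AltSixPSL

end Literature.GroupTheory.SpecificGroups
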